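import Summits.ABC.IUTFork.Cor312Steps
import HarnessLib

/-!
# [IUTchIII] Corollary 3.12 — the least reading of the chain: which loci each observation rests on (c312 crew, VI)

Record-only file (D-0012) of the abc-iut cell; TAKES NO SIDE. `Cor312Steps.lean` types the proof of
[IUTchIII] Cor. 3.12 (kurims pp. 174–186) as twenty Horn-clause inferences `Step.Holds L O` ("cited loci ∧
invoked earlier observations ⟹ observations") over readings `L : Locus → Prop`, `O : Obs → Prop`, and proves
`obs_of_chain`: granting ALL 85 loci, the chain yields all 36 observations. This file sharpens that to the
exact bookkeeping content of the printed dependency structure: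

* `Step.usesClosure s` — the nodes on which node `s` rests through the observations it INVOKES (`Step.uses`,
  read on the page: "we conclude from (xi-e)", "In the context of (v)", …), transitively; explicit data,
  machine-checked closed and tight (`usesClosure_closed`, `usesClosure_tight`). `Step.upstreamLoci s` — the
  loci cited anywhere in that closure.
* `Derivable L o` — THE LEAST READING of the observations given a reading `L` of the loci: `o` is derivable
  iff every locus upstream of the node drawing `o` is granted. PROVED: `chain_derivable` (the least reading
  satisfies the chain) and `derivable_le` (every reading satisfying the chain grants every derivable
  observation) — together `least_reading`: the chain's content is exactly "each observation follows from its
  upstream loci", no more, no less.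
* NUMBERS for the disputed node: `upstream_xi_f` — (xi-f)'s "constitutes … a construction … of `−|log(q)|`"
  rests, through invoked observations, on 75 of the 85 cited sub-item loci; the ten it does NOT rest on are
  the statement-only Rem 3.1.1 and Prop 3.9 (i), the (xi-a)-only Rem 3.12.2 (ii), (iv), the (viii)-only
  [IUTchI] §2, Rem 6.12.4 (iii), [IUTchII] §2, Rem 4.5.3 (iii), the (xi-h)-only [IUTchIV] Rem 2.3.2 (ii) and
  the (xii)-only Rem 3.6.2 (i) (`not_upstream_xi_f`). Through the coarser explicit BACK-REFERENCES
  (`Step.after`: "(x) … one may summarize the discussion thus far") it is 79 of 85 (`afterLoci_xi_f_length`):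
  (viii)'s four loci re-enter. So on either count the disputed node carries (almost) the whole citation
  load of the proof: Steps (i)–(x) are not detachable preliminaries but the premises of (xi-f).
  [claim: Mochizuki2012, status: disputed] — a statement about the TEXT's structure; nothing about validity.

Everything is finite and checked by `decide`; nothing here says which loci hold.
-/

namespace Summit.ABC

namespace IUTFork

namespace Cor312Proof

open Locus Obs

/-! ## 1. The node drawing an observation; the uses-closure of a node -/

/-- The node that draws observation `o` (well defined: `Step.concl_unique`). [claim: Mochizuki2012, status: disputed] -/
def Obs.step (o : Obs) : Step := (Step.all.find? fun s => decide (o ∈ s.concl)).getD .wlog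

/-- `o` is drawn by `o.step`. [folklore] -/
theorem Obs.mem_concl_step : ∀ o ∈ Obs.all, o ∈ o.step.concl := by decide

/-- … and by no other node. [folklore] -/
theorem Obs.step_eq_of_mem : ∀ s ∈ Step.all, ∀ o ∈ s.concl, o.step = s := by decide

namespace Step

/-- The nodes whose observations node `s` invokes. [claim: Mochizuki2012, status: disputed] -/
def usesSteps (s : Step) : List Step := Step.all.filter fun t => decide (∃ o ∈ s.uses, o ∈ t.concl)

/-- The USES-CLOSURE of each node (itself, the nodes it invokes, transitively), as explicit data in printed
order; checked closed and tight below. [claim: Mochizuki2012, status: disputed] -/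
def usesClosure : Step → List Step
  | wlog => [wlog]
  | i => [i]
  | ii => [ii]
  | iii => [iii]
  | iv => [iii, iv]
  | v => [i, v]
  | vi => [i, v, vi]
  | vii => [i, v, vi, vii]
  | viii => [i, v, vi, vii, viii]
  | ix => [i, v, vi, vii, ix]
  | x => [i, ii, iii, iv, v, vi, vii, ix, x]
  | xi_a => [i, xi_a]
  | xi_b => [wlog, i, ii, iii, iv, v, vi, vii, ix, x, xi_b]
  | xi_c => [wlog, i, ii, iii, iv, v, vi, vii, ix, x, xi_b, xi_c]
  | xi_d => [wlog, i, ii, iii, iv, v, vi, vii, ix, x, xi_b, xi_c, xi_d]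
  | xi_e => [wlog, i, ii, iii, iv, v, vi, vii, ix, x, xi_b, xi_c, xi_d, xi_e]
  | xi_f => [wlog, i, ii, iii, iv, v, vi, vii, ix, x, xi_b, xi_c, xi_d, xi_e, xi_f]
  | xi_g => [wlog, i, ii, iii, iv, v, vi, vii, ix, x, xi_b, xi_c, xi_d, xi_e, xi_f, xi_g]
  | xi_h => [i, ii, v, vi, xi_h]
  | xii => [xii]

/-- CLOSED: each node is in its closure, and the closure contains the closures of every invoked node. [folklore] -/
theorem usesClosure_closed :
    ∀ s ∈ all, s ∈ s.usesClosure ∧ ∀ t ∈ s.usesSteps, ∀ u ∈ t.usesClosure, u ∈ s.usesClosure := by decide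

/-- TIGHT: nothing else — every member other than `s` lies in the closure of some invoked node. [folklore] -/
theorem usesClosure_tight :
    ∀ s ∈ all, ∀ u ∈ s.usesClosure, u = s ∨ ∃ t ∈ s.usesSteps, u ∈ t.usesClosure := by decide

/-- The loci cited anywhere upstream of node `s` (in its uses-closure). [claim: Mochizuki2012, status: disputed] -/
def upstreamLoci (s : Step) : List Locus := Locus.all.filter fun c => decide (∃ t ∈ s.usesClosure, c ∈ t.cites)

/-- Membership in `usesSteps`, unfolded. [folklore] -/
theorem mem_usesSteps {s t : Step} : t ∈ s.usesSteps ↔ ∃ o ∈ s.uses, o ∈ t.concl := by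
  simp [usesSteps, List.mem_filter, Step.mem_all]

/-- Membership in `upstreamLoci`, unfolded. [folklore] -/
theorem mem_upstreamLoci {s : Step} {c : Locus} : c ∈ s.upstreamLoci ↔ ∃ t ∈ s.usesClosure, c ∈ t.cites := by
  simp [upstreamLoci, List.mem_filter, Locus.mem_all]

/-- A node's own citations are upstream of it. [folklore] -/
theorem cites_sub_upstream (s : Step) {c : Locus} (hc : c ∈ s.cites) : c ∈ s.upstreamLoci :=
  mem_upstreamLoci.2 ⟨s, (usesClosure_closed s (Step.mem_all s)).1, hc⟩

/-- Decomposition: a locus upstream of `s` is cited by `s` or upstream of a node drawing an invoked observation.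
[folklore] -/
theorem upstream_cases (s : Step) {c : Locus} (hc : c ∈ s.upstreamLoci) :
    c ∈ s.cites ∨ ∃ o ∈ s.uses, c ∈ o.step.upstreamLoci := by
  obtain ⟨t', ht', hct'⟩ := mem_upstreamLoci.1 hc
  rcases usesClosure_tight s (Step.mem_all s) t' ht' with rfl | ⟨t, ht, ht't⟩
  · exact Or.inl hct'
  · obtain ⟨o, ho, hot⟩ := mem_usesSteps.1 ht
    refine Or.inr ⟨o, ho, mem_upstreamLoci.2 ⟨t', ?_, hct'⟩⟩
    rw [Obs.step_eq_of_mem t (Step.mem_all t) o hot]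
    exact ht't

/-- Monotonicity: the loci upstream of a node drawing an invoked observation are upstream of `s`. [folklore] -/
theorem upstream_mono (s : Step) {o : Obs} (ho : o ∈ s.uses) {c : Locus} (hc : c ∈ o.step.upstreamLoci) :
    c ∈ s.upstreamLoci := by
  obtain ⟨t', ht', hct'⟩ := mem_upstreamLoci.1 hc
  have hst : o.step ∈ s.usesSteps := mem_usesSteps.2 ⟨o, ho, Obs.mem_concl_step o (Obs.mem_all o)⟩
  exact mem_upstreamLoci.2 ⟨t', (usesClosure_closed s (Step.mem_all s)).2 _ hst t' ht', hct'⟩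

/-- Invoked observations are drawn strictly earlier. [folklore] -/
theorem uses_step_lt : ∀ s ∈ all, ∀ o ∈ s.uses, o.step.idx < s.idx := by decide

end Step

/-! ## 2. The least reading -/

/-- **THE LEAST READING** of the proof's observations given a reading `L` of the cited loci: observation `o`
is DERIVABLE iff every locus upstream of the node drawing it is granted. [claim: Mochizuki2012, status: disputed] -/
@[claim "Mochizuki2012" "disputed"] def Derivable (L : Locus → Prop) (o : Obs) : Prop :=
  ∀ c ∈ o.step.upstreamLoci, L c

/-- **The least reading satisfies the chain.** [folklore] -/
theorem chain_derivable (L : Locus → Prop) : Chain L (Derivable L) := by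
  intro s hcites huses o ho c hc
  have hs : o.step = s := Obs.step_eq_of_mem s (Step.mem_all s) o ho
  rw [hs] at hc
  rcases Step.upstream_cases s hc with h | ⟨o', ho', hc'⟩
  · exact hcites c h
  · exact huses o' ho' c hc'

/-- **Every reading satisfying the chain grants every derivable observation** (the least reading is least).
[folklore] -/
theorem derivable_le {L : Locus → Prop} {O : Obs → Prop} (hC : Chain L O) : ∀ o, Derivable L o → O o := by
  suffices h : ∀ n : ℕ, ∀ s : Step, s.idx < n → ∀ o ∈ s.concl, Derivable L o → O o by
    intro o hd
    obtain ⟨s, hs⟩ := concl_cover o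
    exact h _ s (Nat.lt_succ_self _) o hs hd
  intro n
  induction n with
  | zero => intro s hs; exact absurd hs (Nat.not_lt_zero _)
  | succ n ih =>
    intro s hs o ho hd
    have hstep : o.step = s := Obs.step_eq_of_mem s (Step.mem_all s) o ho
    refine hC s (fun c hc => hd c ?_) (fun o' ho' => ?_) o ho
    · rw [hstep]; exact Step.cites_sub_upstream s hc
    · have hlt := Step.uses_step_lt s (Step.mem_all s) o' ho'
      refine ih o'.step (by omega) o' (Obs.mem_concl_step o' (Obs.mem_all o')) fun c hc => hd c ?_
      rw [hstep]; exact Step.upstream_mono s ho' hc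

/-- **Least reading, both halves**: the chain's exact content is "each observation follows from the loci
upstream of it" — `Derivable L` satisfies the chain and lies below every `O` that does. [folklore] -/
theorem least_reading (L : Locus → Prop) :
    Chain L (Derivable L) ∧ ∀ O : Obs → Prop, Chain L O → ∀ o, Derivable L o → O o :=
  ⟨chain_derivable L, fun _ hC => derivable_le hC⟩

/-- In particular `obs_of_chain` is the special case `L = ⊤`: everything is derivable when every locus is
granted. [folklore] -/
theorem derivable_of_all {L : Locus → Prop} (hL : ∀ c, L c) (o : Obs) : Derivable L o := fun c _ => hL c

/-! ## 3. Numbers for the disputed node (xi-f) -/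

/-- (xi-f)'s observation is drawn by node (xi-f). [folklore] -/
theorem step_constitutesConstruction : Obs.constitutesConstruction.step = .xi_f := by decide

/-- **The disputed observation is derivable iff the 75 loci upstream of (xi-f) are granted.** [folklore] -/
theorem derivable_constitutesConstruction_iff (L : Locus → Prop) :
    Derivable L .constitutesConstruction ↔ ∀ c ∈ Step.xi_f.upstreamLoci, L c := by
  unfold Derivable; rw [step_constitutesConstruction]

/-- The uses-closure of (xi-f): the opening paragraph, (i)–(vii), (ix), (x), (xi-b)–(xi-f) — fifteen nodes;
NOT (viii), (xi-a), (xi-g), (xi-h), (xii). [claim: Mochizuki2012, status: disputed] -/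
theorem usesClosure_xi_f : Step.xi_f.usesClosure =
    [.wlog, .i, .ii, .iii, .iv, .v, .vi, .vii, .ix, .x, .xi_b, .xi_c, .xi_d, .xi_e, .xi_f] := rfl

/-- **75 of the 85 cited sub-item loci are upstream of (xi-f).** [claim: Mochizuki2012, status: disputed] -/
theorem upstream_xi_f : Step.xi_f.upstreamLoci.length = 75 := by decide

/-- … the ten that are not: Prop 3.9 (i) and Rem 3.1.1 (statement only), Rem 3.6.2 (i) ((xii) only),
Rem 3.12.2 (ii), (iv) ((xi-a) only), [IUTchI] §2 and Rem 6.12.4 (iii), [IUTchII] §2 and Rem 4.5.3 (iii)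
((viii) only), [IUTchIV] Rem 2.3.2 (ii) ((xi-h) only). [claim: Mochizuki2012, status: disputed] -/
theorem not_upstream_xi_f : (Locus.all.filter fun c => decide (c ∉ Step.xi_f.upstreamLoci)) =
    [prop3_9_i, rem3_1_1, rem3_6_2_i, rem3_12_2_ii, rem3_12_2_iv, chI_sec2, chI_rem6_12_4_iii, chII_sec2,
      chII_rem4_5_3_iii, chIV_rem2_3_2_ii] := by decide

/-- The coarser count through explicit BACK-REFERENCES (`Step.after`, transitively; (x): "one may summarize
the discussion thus far" refers back to (i)–(ix), so (viii) re-enters): the loci cited in a node reachable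
from (xi-f) by back-references. [claim: Mochizuki2012, status: disputed] -/
def afterClosureXIf : List Step :=
  [.wlog, .i, .ii, .iii, .iv, .v, .vi, .vii, .viii, .ix, .x, .xi_b, .xi_c, .xi_d, .xi_e, .xi_f]

/-- It is closed under `Step.after` and starts at (xi-f). [folklore] -/
theorem afterClosureXIf_closed :
    Step.xi_f ∈ afterClosureXIf ∧ ∀ s ∈ afterClosureXIf, ∀ t ∈ s.after, t ∈ afterClosureXIf := by decide

/-- **79 of the 85 loci are cited in a node (xi-f) refers back to, transitively**; the six others: Prop 3.9
(i), Rem 3.1.1 (statement only), Rem 3.6.2 (i) ((xii)), Rem 3.12.2 (ii), (iv) ((xi-a)), [IUTchIV] Rem 2.3.2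
(ii) ((xi-h)). [claim: Mochizuki2012, status: disputed] -/
theorem afterLoci_xi_f_length :
    (Locus.all.filter fun c => decide (∃ t ∈ afterClosureXIf, c ∈ t.cites)).length = 79 ∧
      (Locus.all.filter fun c => decide (¬ ∃ t ∈ afterClosureXIf, c ∈ t.cites)) =
        [prop3_9_i, rem3_1_1, rem3_6_2_i, rem3_12_2_ii, rem3_12_2_iv, chIV_rem2_3_2_ii] := by decide

end Cor312Proof

end IUTFork

end Summit.ABC
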